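import Summits.QuantumFields.BalabanUV.Beta.D1BFx.FineHessianLegGrades
import Summits.QuantumFields.BalabanUV.Beta.D1BFx.DiagonalLegGrade
import Summits.QuantumFields.BalabanUV.Beta.D1BFx.FrozenCorner

/-!
# `BalabanUV.Beta.D1BFx.FrozenLegProfile` — road «BF-x» for binder row D1, slot (SPLIT), sub-leaf (5d-leg): THE ROAD'S FROZEN SCALAR LEG
# `gfrz n a b` (OWNER RULING R-10′: the component-averaged diagonal entry of the gluon leg at the base site `b`, SYMMETRISED UNDER ALL SIXTEEN
# AXIS-SIGN PATTERNS), ITS REFLECTION SYMMETRIES (`gfrz_negAt` — the leg hypothesis of `FrozenCorner.bfKernel_cornerRefl`), ITS EXPONENTIAL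
# BOUND (so `frozenLeg (gfrz n a b)` is a spread leg), THE CUBIC SYMMETRY OF THE FREE LEG `G₀` IT IS COMPARED WITH, AND THE END's WINDOW ROWS
# h0/h1 FOR IT — UNCONDITIONALLY from leaf-08's `DiagonalLegGrade` — plus the remaining rows h2/d0/d1/d2 BY CONVEXITY from per-profile rows

HONEST DEPENDENCY (page 1, mandatory): continuum YM on T⁴ ⇐ BetaPertH ∧ nine spine estimates (0/9 proved); BetaPertH ⇐ (D1) ∧ (D4) ∧
CAP+tail; G-an2-4 gates asym, D1 and NE2/3/4.  HONEST FRAMING (cell contract, verbatim): «discharging `BetaPertH` makes Bałaban's UV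
stability UNCONDITIONAL — a real constructive-QFT result; it is NOT the continuum limit and NOT the Clay problem.»  THIS MODULE DISCHARGES
NOTHING of the wall: definitions with bodies ([our objects] `sgnVec`/`sgnVecR` (sign patterns acting on `ℤ^d`/momenta), `sgnEquiv`, `xorEquiv`,
`gProf` (the 64 reflected diagonal profiles), `avg64`, **`gfrz`** (R-10′ verbatim), `flatK`) and [folklore] lemmas: a change of variables in
the Brillouin-zone integral (`latticeGreen_sgnVec`, Mathlib's `measurePreserving_pi`/`Measure.measurePreserving_neg`/
`MeasurePreserving.setIntegral_preimage_emb`), finite re-indexing of sign patterns, the triangle inequality, and leaf-08's UNCONDITIONAL window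
grades `DiagonalLegGrade.abs_Kinf_diag_sub_G₀_le`/`abs_Kinf_diag_flat_sub_right_le` composed BY NAME.  No `Prop` is minted, nothing is cited,
no hypothesis is a printed statement, 0 sorry.  0 wall binders instantiated; NOT the (SPLIT) slot, NOT D1, NOT `BetaPertH`, NOT continuum,
NOT Clay.

ABSOLUTE RULE (cell charter, verbatim): «No internally-minted statement may enter as a cited fact. Every hypothesis is either kernel-proved in
this package or a verbatim quotation of a PUBLISHED theorem with page reference. The manuscript(s) under audit are NOT citable for their own
disputed steps — they are the thing under adjudication; programme-internal (2001/route/tribunal) claims are never citable.»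

WHY (owner d1-p2-g2, rulings R-10′ (journal 2026-08-20 14:22Z) and TAKE line (14:27Z): «the LEG half — [our object] `gfrz n a b` per R-10′ + its six END
rows by convexity from an5's per-component rows — REMAINS OPEN, first refusal ANY SEAT»; `SPLIT-SPEC.md` v1 §1/§4 (5d)).  R-10′: `Gf n b v :=
(1/64)·Σ_{ε ∈ {±1}⁴} Σ_κ (Ga n a) b (b + ε•v) κ κ`.  The road's MAIN kernel `lam·bfKernel (Gf n b) N u_μ u_ν` is corner-odd (`FrozenCorner.bfKernel_cornerRefl`)
as soon as the leg satisfies `∀ w, Gf n b (negAt μ w) = Gf n b w` — THIS FILE's `gfrz_negAt`; the slot-(F) words over `frozenLeg (Gf n b)` need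
`Spr` — THIS FILE's `decay_gfrz` + part 2's `spr_frozenLeg`; the END (`RoadEnd.d1Drift_of_strongRoad`) consumes six rows h0/h1/h2/d0/d1/d2 of the
family `Gf` against `gFree` — THIS FILE proves h0 and h1 for `gfrz` OUTRIGHT on all of `ℤ⁴` (constants `(woodburyDc 0 + ellD0 4 a)/n²`,
`(woodburyD1c 0 + ellD1 4 a)/n³`, every `n ≥ 1`, `a > 0`) and reduces h2/d0/d1/d2 to the same rows for the 64 reflected per-component profiles
`gProf n a b ε κ v := (Ga n a) b (b + ε•v) κ κ` (convexity; the per-profile h2 needs a far–far second difference and the d-rows need the scale-`n`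
tails of `K^∞` — B5 Prop. 1.2 content, the (α)-leaf, NOT in the tree; nothing is minted: they stay displayed hypotheses of the transfer lemmas).
The comparison with `gFree` across sign patterns needs `G₀ (ε•v) = G₀ v` — the CUBIC REFLECTION SYMMETRY OF THE LATTICE GREEN FUNCTION, proved
here from its Brillouin-zone integral (`latticeGreen_sgnVec`; the tree had only `latticeGreen_neg`).

CONTENT.
* §0 [our objects] `sgnVec ε v`, `sgnVecR ε p`; [folklore] **`latticeGreen_sgnVec`**, `G₀_sgnVec`, `gFree_sgnVec` (change of variables `p ↦ ε•p`).
* §1 [folklore] sign-pattern algebra: `sgnVec_add`, `sgnVec_sgnVec`, `negAt_eq_sgnVec`, `neg_eq_sgnVec`, `l1_sgnVec`, `sgnVec_unitVec_of_false/_true`; `xorEquiv`.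
* §2 [our objects] `gProf`, `avg64`, **`gfrz`** (R-10′), `gfrz_eq_avg64`; [folklore] `avg64_const`/`_sub`/`abs_avg64_le`, **`gfrz_sgnVec`** (invariance under
  every sign pattern), **`gfrz_negAt`**, `gfrz_neg`, **`decay_gfrz`**, `spr_frozenLeg_gfrz`, **`bfKernel_gfrz_cornerRefl`** (junction with `FrozenCorner`).
* §3 [folklore] rows: `flatK`; **`abs_gProf_sub_gFree_le`**/**`abs_gfrz_sub_gFree_le`** (h0, unconditional), **`abs_gProf_diff_flat_le`**/**`abs_gfrz_diff_flat_le`**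
  (h1, unconditional); `abs_gfrz_h2_of_gProf`, `abs_gfrz_d0_of_gProf`, `abs_gfrz_d1_of_gProf`, `abs_gfrz_d2_of_gProf` (convexity transfers).
Unit `b2b-balaban-beta-d1-formalise-leaf-03` (gen 3); `LEAVES-BFx.md` row A0/(5d-leg).
-/

noncomputable section

namespace Summit.QuantumFields.BalabanUV.Beta.D1BFx.FrozenLegProfile

open MeasureTheory Finset
open scoped BigOperators
open Literature.Probability.LatticeModels (latticeGreen brillouin dispersion)
open Literature.MathematicalPhysics.QuantumFieldTheory.Balaban1983to89
open Literature.MathematicalPhysics.QuantumFieldTheory.Balaban1983to89.Beta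
open B12Sec2to5 (l1)
open ExpKernelCalculus (Site MKer)
open PoissonInterior (G₀)
open GhostTable (gFree)
open SpinTable (bfKernel)
open DyadicShell (Pt)
open BubbleTransfer (unitVec)
open VectorPropagatorLimit (Kinf)
open LongitudinalWindow (ellD0 ellD1)
open WoodburyCovariant (woodburyDc woodburyD1c)
open Summit.QuantumFields.BalabanUV.Beta.TameKernelCalculus (Spr)
open Summit.QuantumFields.BalabanUV.Beta.D1BFx.GluonLeg (Ga Ga_apply)
open Summit.QuantumFields.BalabanUV.Beta.D1BFx.DiagonalLegGrade (abs_Kinf_diag_sub_G₀_le abs_Kinf_diag_flat_sub_right_le)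
open Summit.QuantumFields.BalabanUV.Beta.D1BFx.FineHessianLegGrades (frozenLeg spr_frozenLeg)
open Summit.QuantumFields.BalabanUV.Beta.D1BFx.FrozenCorner (negAt cornerRefl bfKernel_cornerRefl)

/-! ## §0 Sign patterns and the cubic reflection symmetry of the lattice Green function -/

section Green

variable {d : ℕ}

/-- [our object] THE ACTION OF A SIGN PATTERN `ε ∈ {±1}^d` (coded `Fin d → Bool`, `true` = flip) on `ℤ^d`: `(ε•v)_i = −v_i` if `ε_i`, else `v_i`. -/
def sgnVec (ε : Fin d → Bool) (v : Fin d → ℤ) : Fin d → ℤ := fun i => if ε i then -v i else v i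

/-- [our object] The same action on momenta `p ∈ ℝ^d`. -/
def sgnVecR (ε : Fin d → Bool) (p : Fin d → ℝ) : Fin d → ℝ := fun i => if ε i then -p i else p i

/-- [our object] Unfolding. -/ theorem sgnVec_apply (ε : Fin d → Bool) (v : Fin d → ℤ) (i : Fin d) : sgnVec ε v i = if ε i then -v i else v i := rfl

/-- [folklore] The momentum action is an involution. -/
theorem sgnVecR_sgnVecR (ε : Fin d → Bool) (p : Fin d → ℝ) : sgnVecR ε (sgnVecR ε p) = p := by
  funext i; by_cases h : ε i <;> simp [sgnVecR, h]

/-- [folklore] The momentum action is measurable. -/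
theorem measurable_sgnVecR (ε : Fin d → Bool) : Measurable (sgnVecR (d := d) ε) := by
  refine measurable_pi_lambda _ fun i => ?_
  by_cases h : ε i
  · simp only [sgnVecR, h, if_true]; exact (measurable_pi_apply i).neg
  · simp only [sgnVecR, h]; exact measurable_pi_apply i

/-- [our object] The momentum action as a measurable equivalence of `ℝ^d`. -/
def sgnEquiv (ε : Fin d → Bool) : (Fin d → ℝ) ≃ᵐ (Fin d → ℝ) where
  toFun := sgnVecR ε
  invFun := sgnVecR ε
  left_inv := sgnVecR_sgnVecR ε
  right_inv := sgnVecR_sgnVecR ε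
  measurable_toFun := measurable_sgnVecR ε
  measurable_invFun := measurable_sgnVecR ε

/-- [folklore] **THE MOMENTUM REFLECTIONS PRESERVE LEBESGUE MEASURE** (coordinatewise `Measure.measurePreserving_neg`, `measurePreserving_pi`). -/
theorem measurePreserving_sgnVecR (ε : Fin d → Bool) :
    MeasurePreserving (sgnVecR (d := d) ε) (volume : Measure (Fin d → ℝ)) volume := by
  have h := MeasureTheory.measurePreserving_pi (fun _ : Fin d => (volume : Measure ℝ)) (fun _ => volume)
    (f := fun i => if ε i then (fun x : ℝ => -x) else id) (fun i => by
      by_cases hi : ε i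
      · simp only [hi, if_true]; exact Measure.measurePreserving_neg _
      · simp only [hi]; exact MeasurePreserving.id _)
  have e : (fun (a : Fin d → ℝ) (i : Fin d) => (if ε i then (fun x : ℝ => -x) else id) (a i)) = sgnVecR ε := by
    funext p i
    by_cases hi : ε i <;> simp [sgnVecR, hi]
  rw [e] at h
  rw [MeasureTheory.volume_pi]
  exact h

/-- [folklore] The Brillouin zone `[−π, π]^d` is invariant under the momentum reflections. -/
theorem sgnVecR_preimage_brillouin (ε : Fin d → Bool) : sgnVecR ε ⁻¹' brillouin d = brillouin d := by
  ext p
  simp only [brillouin, Set.mem_preimage, Set.mem_pi, Set.mem_univ, true_implies, Set.mem_Icc, sgnVecR]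
  constructor
  · intro h i
    have := h i
    by_cases hi : ε i
    · simp only [hi, if_true] at this; constructor <;> linarith [this.1, this.2]
    · simpa [hi] using this
  · intro h i
    have := h i
    by_cases hi : ε i
    · simp only [hi, if_true]; constructor <;> linarith [this.1, this.2]
    · simpa [hi] using this

/-- [folklore] **CUBIC REFLECTION SYMMETRY OF THE LATTICE GREEN FUNCTION**: `latticeGreen (ε•z) = latticeGreen z` for every sign pattern `ε` —
the integrand `cos (p·z)/ε(p)` of the Brillouin-zone integral satisfies `cos (p·(ε•z)) = cos ((ε•p)·z)`, `ε(ε•p) = ε(p)`, and `p ↦ ε•p` preserves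
Lebesgue measure and the zone.  (The tree had the special case `latticeGreen_neg`.) -/
theorem latticeGreen_sgnVec (ε : Fin d → Bool) (z : Fin d → ℤ) : latticeGreen (sgnVec ε z) = latticeGreen z := by
  unfold latticeGreen
  congr 1
  set g : (Fin d → ℝ) → ℝ := fun q => Real.cos (∑ i, q i * (z i : ℝ)) / dispersion q with hg
  have key : ∀ p : Fin d → ℝ, Real.cos (∑ i, p i * ((sgnVec ε z i : ℤ) : ℝ)) / dispersion p = g (sgnVecR ε p) := by
    intro p
    simp only [hg, dispersion, sgnVec, sgnVecR]
    congr 1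
    · congr 1
      refine Finset.sum_congr rfl fun i _ => ?_
      by_cases hi : ε i <;> simp [hi]
    · refine Finset.sum_congr rfl fun i _ => ?_
      by_cases hi : ε i <;> simp [hi, Real.cos_neg]
  simp_rw [key]
  have h1 : (∫ p in brillouin d, g (sgnVecR ε p)) = ∫ p in sgnVecR ε ⁻¹' brillouin d, g (sgnVecR ε p) := by
    rw [sgnVecR_preimage_brillouin]
  rw [h1]
  exact (measurePreserving_sgnVecR ε).setIntegral_preimage_emb (sgnEquiv ε).measurableEmbedding g (brillouin d)

/-- [folklore] Hence the free leg `G₀ = latticeGreen/2` is invariant under every sign pattern. -/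
theorem G₀_sgnVec (ε : Fin d → Bool) (z : Fin d → ℤ) : G₀ (sgnVec ε z) = G₀ z := by
  simp only [G₀, latticeGreen_sgnVec]

end Green

/-- [folklore] … and so is an3's `gFree` (`= G₀` on `ℤ⁴`, definitionally). -/
theorem gFree_sgnVec (ε : Fin 4 → Bool) (v : Pt) : gFree (sgnVec ε v) = gFree v := by
  show G₀ (sgnVec ε v) = G₀ v
  exact G₀_sgnVec ε v

/-! ## §1 Sign-pattern algebra on `ℤ⁴` -/

/-- [folklore] The action is additive. -/
theorem sgnVec_add {d : ℕ} (ε : Fin d → Bool) (v w : Fin d → ℤ) : sgnVec ε (v + w) = sgnVec ε v + sgnVec ε w := by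
  funext i
  simp only [sgnVec, Pi.add_apply]
  split_ifs <;> ring

/-- [folklore] Composition of two sign patterns is their pointwise `xor`. -/
theorem sgnVec_sgnVec {d : ℕ} (ε ε' : Fin d → Bool) (v : Fin d → ℤ) : sgnVec ε (sgnVec ε' v) = sgnVec (fun i => xor (ε i) (ε' i)) v := by
  funext i; cases h : ε i <;> cases h' : ε' i <;> simp [sgnVec, h, h']

/-- [folklore] `FrozenCorner.negAt μ` (the axis reflection `R_μ`) is the sign pattern `[· = μ]`. -/
theorem negAt_eq_sgnVec (μ : Fin 4) (w : Pt) : negAt μ w = sgnVec (fun i => decide (i = μ)) w := by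
  funext i; by_cases h : i = μ <;> simp [negAt, sgnVec, h]

/-- [folklore] Point inversion is the all-flip pattern. -/
theorem neg_eq_sgnVec {d : ℕ} (w : Fin d → ℤ) : -w = sgnVec (fun _ => true) w := by
  funext i; simp [sgnVec]

/-- [folklore] Sign patterns preserve the `ℓ¹` length. -/
theorem l1_sgnVec {d : ℕ} (ε : Fin d → Bool) (v : Fin d → ℤ) : l1 (sgnVec ε v) = l1 v := by
  simp only [l1, sgnVec]
  refine Finset.sum_congr rfl fun i _ => ?_
  by_cases h : ε i <;> simp [h, abs_neg]

/-- [folklore] `ε•e_ρ = e_ρ` when `ε_ρ` does not flip. -/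
theorem sgnVec_unitVec_of_false {ε : Fin 4 → Bool} {ρ : Fin 4} (h : ε ρ = false) : sgnVec ε (unitVec ρ) = Pi.single ρ 1 := by
  funext i
  by_cases hi : i = ρ
  · subst hi; simp [sgnVec, h, unitVec]
  · simp [sgnVec, unitVec, hi]

/-- [folklore] `ε•e_ρ = −e_ρ` when `ε_ρ` flips. -/
theorem sgnVec_unitVec_of_true {ε : Fin 4 → Bool} {ρ : Fin 4} (h : ε ρ = true) : sgnVec ε (unitVec ρ) = -Pi.single ρ 1 := by
  funext i
  by_cases hi : i = ρ
  · subst hi; simp [sgnVec, h, unitVec]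
  · simp [sgnVec, unitVec, hi]

/-- [our object] Right-`xor` by a fixed pattern, an involution of `{±1}⁴` (re-indexes the symmetrisation sum). -/
def xorEquiv (ε' : Fin 4 → Bool) : (Fin 4 → Bool) ≃ (Fin 4 → Bool) :=
  Function.Involutive.toPerm (fun ε i => xor (ε i) (ε' i)) (fun ε => by funext i; simp)

/-- [our object] Unfolding. -/
theorem xorEquiv_apply (ε' ε : Fin 4 → Bool) : xorEquiv ε' ε = fun i => xor (ε i) (ε' i) := rfl

/-! ## §2 The road's frozen scalar leg `gfrz` (R-10′), its symmetries, its exponential bound -/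

section Leg

variable (n : ℕ) [NeZero n] (a : ℝ) (b : Pt)

/-- [our object] THE 64 REFLECTED DIAGONAL PROFILES of the gluon leg at the base site `b`: `gProf n a b ε κ v := (Ga n a) b (b + ε•v) κ κ`. -/
def gProf (ε : Fin 4 → Bool) (κ : Fin 4) (v : Pt) : ℝ := Ga n a b (b + sgnVec ε v) κ κ

/-- [our object] The average over sign patterns and components: `avg64 F := (1/64)·Σ_ε Σ_κ F ε κ`. -/
def avg64 (F : (Fin 4 → Bool) → Fin 4 → ℝ) : ℝ := (1 / 64 : ℝ) * ∑ ε : Fin 4 → Bool, ∑ κ : Fin 4, F ε κ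

/-- [our object] **THE ROAD'S FROZEN SCALAR LEG (OWNER RULING R-10′, verbatim)**: `gfrz n a b v := (1/64)·Σ_{ε ∈ {±1}⁴} Σ_κ (Ga n a) b (b + ε•v) κ κ` —
the component-averaged diagonal entry of `K^∞` at the base site, symmetrised under all axis-sign patterns.  A DEFINITION; asserts nothing. -/
def gfrz (n : ℕ) [NeZero n] (a : ℝ) (b v : Pt) : ℝ :=
  (1 / 64 : ℝ) * ∑ ε : Fin 4 → Bool, ∑ κ : Fin 4, Ga n a b (b + sgnVec ε v) κ κ

variable {n a b}

/-- [our object] `gfrz` is the `avg64` of the reflected profiles. -/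
theorem gfrz_eq_avg64 (v : Pt) : gfrz n a b v = avg64 (fun ε κ => gProf n a b ε κ v) := rfl

/-- [folklore] There are `16 · 4 = 64` summands. -/
theorem avg64_const (c : ℝ) : avg64 (fun _ _ => c) = c := by
  simp only [avg64, Finset.sum_const, Finset.card_univ, Fintype.card_fun, Fintype.card_bool, Fintype.card_fin, nsmul_eq_mul]
  push_cast
  ring

/-- [folklore] `avg64` is additive … -/
theorem avg64_add (F G : (Fin 4 → Bool) → Fin 4 → ℝ) : avg64 (fun ε κ => F ε κ + G ε κ) = avg64 F + avg64 G := by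
  simp only [avg64, Finset.sum_add_distrib, mul_add]

/-- [folklore] … and subtractive. -/
theorem avg64_sub (F G : (Fin 4 → Bool) → Fin 4 → ℝ) : avg64 (fun ε κ => F ε κ - G ε κ) = avg64 F - avg64 G := by
  simp only [avg64, Finset.sum_sub_distrib, mul_sub]

/-- [folklore] **CONVEXITY**: a uniform bound on the 64 summands bounds the average. -/
theorem abs_avg64_le {F : (Fin 4 → Bool) → Fin 4 → ℝ} {B : ℝ} (h : ∀ ε κ, |F ε κ| ≤ B) : |avg64 F| ≤ B := by
  rw [avg64, abs_mul, abs_of_pos (by norm_num : (0 : ℝ) < 1 / 64)]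
  have h1 : |∑ ε : Fin 4 → Bool, ∑ κ : Fin 4, F ε κ| ≤ ∑ ε : Fin 4 → Bool, ∑ κ : Fin 4, B :=
    (Finset.abs_sum_le_sum_abs _ _).trans (Finset.sum_le_sum fun ε _ => (Finset.abs_sum_le_sum_abs _ _).trans (Finset.sum_le_sum fun κ _ => h ε κ))
  simp only [Finset.sum_const, Finset.card_univ, Fintype.card_fun, Fintype.card_bool, Fintype.card_fin, nsmul_eq_mul] at h1
  push_cast at h1
  linarith

/-- [folklore] **`gfrz` IS INVARIANT UNDER EVERY SIGN PATTERN** (re-index `ε ↦ ε xor ε′`). -/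
theorem gfrz_sgnVec (ε' : Fin 4 → Bool) (v : Pt) : gfrz n a b (sgnVec ε' v) = gfrz n a b v := by
  simp only [gfrz, sgnVec_sgnVec]
  congr 1
  exact Fintype.sum_equiv (xorEquiv ε') _ _ fun ε => by rw [xorEquiv_apply]

/-- [folklore] **`gfrz` IS `R_μ`-INVARIANT FOR EVERY AXIS** — the leg hypothesis `hg` of `FrozenCorner.bfKernel_cornerRefl`/`cellForm_cornerRefl`. -/
theorem gfrz_negAt (μ : Fin 4) (w : Pt) : gfrz n a b (negAt μ w) = gfrz n a b w := by
  rw [negAt_eq_sgnVec, gfrz_sgnVec]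

/-- [folklore] `gfrz` is even. -/
theorem gfrz_neg (w : Pt) : gfrz n a b (-w) = gfrz n a b w := by
  rw [neg_eq_sgnVec, gfrz_sgnVec]

/-- [folklore] **THE JUNCTION WITH `FrozenCorner`**: the road's frozen MAIN kernel over `gfrz` is ODD under the corner reflection (`ν ≠ μ`), so its zeroth
and `ν`-first moments vanish exactly (`FrozenCorner.tsum_eq_zero_of_cornerOdd`/`tsum_firstMoment_eq_zero_of_cornerOdd`). -/
theorem bfKernel_gfrz_cornerRefl {μ ν : Fin 4} (hνμ : ν ≠ μ) (N : ℝ) (w : Pt) :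
    bfKernel (gfrz n a b) N (unitVec μ) (unitVec ν) (cornerRefl μ w) = -bfKernel (gfrz n a b) N (unitVec μ) (unitVec ν) w :=
  bfKernel_cornerRefl hνμ (gfrz_negAt (n := n) (a := a) (b := b) μ) N w

/-- [folklore] **EVERY REFLECTED PROFILE DECAYS** under T1's standing binder `Spr (Ga n a)` (`|ε•v|₁ = |v|₁`), with the leg's own constants. -/
theorem decay_gProf {C δ : ℝ} (hGa : ExpKernelCalculus.Decays (Ga n a) C δ) (ε : Fin 4 → Bool) (κ : Fin 4) (v : Pt) :
    |gProf n a b ε κ v| ≤ C * Real.exp (-δ * l1 v) := by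
  have h := hGa b (b + sgnVec ε v) κ κ
  rwa [show b - (b + sgnVec ε v) = -sgnVec ε v by abel, neg_eq_sgnVec, sgnVec_sgnVec, l1_sgnVec] at h

/-- [folklore] **THE FROZEN LEG DECAYS**: `Spr (Ga n a)` ⇒ `∃ C δ > 0, ∀ v, |gfrz n a b v| ≤ C e^{−δ|v|₁}` (convexity over the 64 profiles). -/
theorem decay_gfrz (hGa : Spr (Ga n a)) (b : Pt) : ∃ C δ : ℝ, 0 < δ ∧ ∀ v : Pt, |gfrz n a b v| ≤ C * Real.exp (-δ * l1 v) := by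
  obtain ⟨C, δ, hδ, h⟩ := hGa
  exact ⟨C, δ, hδ, fun v => by rw [gfrz_eq_avg64]; exact abs_avg64_le fun ε κ => decay_gProf h ε κ v⟩

/-- [folklore] Hence MAIN's leg `frozenLeg (gfrz n a b)` is a spread leg on any finite fibre (part 2's `spr_frozenLeg`). -/
theorem spr_frozenLeg_gfrz {F : Type*} [Fintype F] [DecidableEq F] (hGa : Spr (Ga n a)) (b : Pt) : Spr (frozenLeg (gfrz n a b) : MKer 4 F) := by
  obtain ⟨C, δ, hδ, h⟩ := decay_gfrz hGa b
  exact spr_frozenLeg hδ h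

end Leg

/-! ## §3 The END's rows for `gfrz`: h0 and h1 unconditionally (leaf-08), h2/d0/d1/d2 by convexity -/

section Rows

variable (n : ℕ) [NeZero n] (hn : 1 ≤ n) {a : ℝ} (ha : 0 < a) (b : Pt)

/-- [our object] The flat part of a diagonal entry seen from the base site: `flatK n a b κ y := K^∞((b,κ),(y,κ)) − G₀(y − b)`. -/
def flatK (n : ℕ) [NeZero n] (a : ℝ) (b : Pt) (κ : Fin 4) (y : Pt) : ℝ := Kinf n a (b, κ) (y, κ) - G₀ (y - b)

/-- [folklore] A reflected profile minus the free leg IS the flat part at the reflected far point (`G₀ (ε•v) = G₀ v`, §0). -/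
theorem gProf_sub_gFree (ε : Fin 4 → Bool) (κ : Fin 4) (v : Pt) :
    gProf n a b ε κ v - gFree v = flatK n a b κ (b + sgnVec ε v) := by
  rw [flatK, gProf, Ga_apply, add_sub_cancel_left, ← gFree_sgnVec ε v]
  rfl

include hn ha

/-- [folklore] **ROW h0 FOR EVERY REFLECTED PROFILE** (leaf-08's `abs_Kinf_diag_sub_G₀_le` + §0): `|gProf ε κ v − gFree v| ≤ (woodburyDc 0 + ellD0 4 a)/n²`. -/
theorem abs_gProf_sub_gFree_le (ε : Fin 4 → Bool) (κ : Fin 4) (v : Pt) :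
    |gProf n a b ε κ v - gFree v| ≤ (woodburyDc 0 + ellD0 4 a) / (n : ℝ) ^ 2 := by
  rw [gProf_sub_gFree]
  exact abs_Kinf_diag_sub_G₀_le n hn ha κ b _

/-- [folklore] **ROW h0 FOR THE ROAD'S FROZEN LEG, UNCONDITIONALLY**: `|gfrz n a b v − gFree v| ≤ (woodburyDc 0 + ellD0 4 a)/n²` on all of `ℤ⁴`, every
base site, every `n ≥ 1`, `a > 0`. -/
theorem abs_gfrz_sub_gFree_le (v : Pt) : |gfrz n a b v - gFree v| ≤ (woodburyDc 0 + ellD0 4 a) / (n : ℝ) ^ 2 := by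
  rw [gfrz_eq_avg64, ← avg64_const (gFree v), ← avg64_sub]
  exact abs_avg64_le fun ε κ => abs_gProf_sub_gFree_le n hn ha b ε κ v

/-- [folklore] **ROW h1 FOR EVERY REFLECTED PROFILE** (leaf-08's far-end grade `abs_Kinf_diag_flat_sub_right_le`, at `y` or at `y − e_ρ` according to
the sign `ε_ρ`): `|(gProf (v + e_ρ) − gFree (v + e_ρ)) − (gProf v − gFree v)| ≤ (woodburyD1c 0 + ellD1 4 a)/n³`. -/
theorem abs_gProf_diff_flat_le (ε : Fin 4 → Bool) (κ : Fin 4) (v : Pt) (ρ : Fin 4) :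
    |(gProf n a b ε κ (v + unitVec ρ) - gFree (v + unitVec ρ)) - (gProf n a b ε κ v - gFree v)| ≤
      (woodburyD1c 0 + ellD1 4 a) / (n : ℝ) ^ 3 := by
  rw [gProf_sub_gFree, gProf_sub_gFree, sgnVec_add]
  cases hρ : ε ρ
  · rw [sgnVec_unitVec_of_false hρ, ← add_assoc]
    have h := abs_Kinf_diag_flat_sub_right_le n hn ha κ ρ b (b + sgnVec ε v)
    simp only [flatK]
    rwa [show b + sgnVec ε v + Pi.single ρ 1 - b = sgnVec ε v + Pi.single ρ 1 by abel,
      show b + sgnVec ε v - b = sgnVec ε v by abel] at h ⊢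
  · rw [sgnVec_unitVec_of_true hρ]
    have h := abs_Kinf_diag_flat_sub_right_le n hn ha κ ρ b (b + sgnVec ε v + -Pi.single ρ 1)
    simp only [flatK]
    rw [show b + sgnVec ε v + -Pi.single ρ 1 + Pi.single ρ 1 = b + sgnVec ε v by abel] at h
    rw [← add_assoc, abs_sub_comm]
    rwa [show b + sgnVec ε v - b = sgnVec ε v by abel, show b + sgnVec ε v + -Pi.single ρ 1 - b = sgnVec ε v + -Pi.single ρ 1 by abel] at h ⊢

/-- [folklore] **ROW h1 FOR THE ROAD'S FROZEN LEG, UNCONDITIONALLY**: `≤ (woodburyD1c 0 + ellD1 4 a)/n³` on all of `ℤ⁴`. -/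
theorem abs_gfrz_diff_flat_le (v : Pt) (ρ : Fin 4) :
    |(gfrz n a b (v + unitVec ρ) - gFree (v + unitVec ρ)) - (gfrz n a b v - gFree v)| ≤ (woodburyD1c 0 + ellD1 4 a) / (n : ℝ) ^ 3 := by
  rw [gfrz_eq_avg64, gfrz_eq_avg64, ← avg64_const (gFree (v + unitVec ρ)), ← avg64_const (gFree v), ← avg64_sub, ← avg64_sub, ← avg64_sub]
  exact abs_avg64_le fun ε κ => abs_gProf_diff_flat_le n hn ha b ε κ v ρ

omit hn ha

/-- [folklore] **ROW h2 BY CONVEXITY**: a uniform bound on the mixed second window difference of the 64 reflected profiles at `v` bounds that of `gfrz`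
(the per-profile far–far second difference of `K^∞ − G₀` is an (α)-leaf input, not in the tree — displayed, not minted). -/
theorem abs_gfrz_h2_of_gProf {μ ν : Fin 4} {B : ℝ} (v : Pt)
    (h : ∀ ε κ, |(gProf n a b ε κ (v + unitVec ν + unitVec μ) - gFree (v + unitVec ν + unitVec μ))
        - (gProf n a b ε κ (v + unitVec ν) - gFree (v + unitVec ν)) - (gProf n a b ε κ (v + unitVec μ) - gFree (v + unitVec μ))
        + (gProf n a b ε κ v - gFree v)| ≤ B) :
    |(gfrz n a b (v + unitVec ν + unitVec μ) - gFree (v + unitVec ν + unitVec μ)) - (gfrz n a b (v + unitVec ν) - gFree (v + unitVec ν))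
        - (gfrz n a b (v + unitVec μ) - gFree (v + unitVec μ)) + (gfrz n a b v - gFree v)| ≤ B := by
  simp only [gfrz_eq_avg64]
  rw [← avg64_const (gFree (v + unitVec ν + unitVec μ)), ← avg64_const (gFree (v + unitVec ν)), ← avg64_const (gFree (v + unitVec μ)),
    ← avg64_const (gFree v)]
  simp only [← avg64_sub, ← avg64_add]
  exact abs_avg64_le h

/-- [folklore] **ROW d0 BY CONVEXITY**: a uniform bound on the 64 reflected profiles at `v` bounds `gfrz` at `v` (instantiate `B` with the END's envelope
`A₀ e^{−(δ/n)‖v‖∞}/‖v‖∞²`, which is sign-pattern invariant). -/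
theorem abs_gfrz_d0_of_gProf {B : ℝ} (v : Pt) (h : ∀ ε κ, |gProf n a b ε κ v| ≤ B) : |gfrz n a b v| ≤ B := by
  rw [gfrz_eq_avg64]; exact abs_avg64_le h

/-- [folklore] **ROW d1 BY CONVEXITY**. -/
theorem abs_gfrz_d1_of_gProf {B : ℝ} (v : Pt) (ρ : Fin 4) (h : ∀ ε κ, |gProf n a b ε κ (v + unitVec ρ) - gProf n a b ε κ v| ≤ B) :
    |gfrz n a b (v + unitVec ρ) - gfrz n a b v| ≤ B := by
  rw [gfrz_eq_avg64, gfrz_eq_avg64, ← avg64_sub]; exact abs_avg64_le h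

/-- [folklore] **ROW d2 BY CONVEXITY**. -/
theorem abs_gfrz_d2_of_gProf {μ ν : Fin 4} {B : ℝ} (v : Pt)
    (h : ∀ ε κ, |gProf n a b ε κ (v + unitVec ν + unitVec μ) - gProf n a b ε κ (v + unitVec ν) - gProf n a b ε κ (v + unitVec μ)
        + gProf n a b ε κ v| ≤ B) :
    |gfrz n a b (v + unitVec ν + unitVec μ) - gfrz n a b (v + unitVec ν) - gfrz n a b (v + unitVec μ) + gfrz n a b v| ≤ B := by
  simp only [gfrz_eq_avg64, ← avg64_sub, ← avg64_add]
  exact abs_avg64_le h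

end Rows

end Summit.QuantumFields.BalabanUV.Beta.D1BFx.FrozenLegProfile

end
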